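import Summits.CriticalPhenomena.SAWScalingLimit.Theorems.SAWDevelopingMapHexConjectureFloorAssembly
import Summits.CriticalPhenomena.SAWScalingLimit.Theorems.SAWDevelopingMapHexConjectureNonRetracingOfModulus
import Summits.CriticalPhenomena.SAWScalingLimit.Theorems.ObservableToSLE.Negative.ModulusNecessity
import HarnessLib

/-!
# Crux `HexConjecture` (stmt-CriticalPhenomena-0808), line `root-locality-replaces-loewner`:
the floor class from the THREE SHARED ESTIMATES — no tightness input

Landing target:
`Summits/CriticalPhenomena/SAWScalingLimit/Theorems/SAWDevelopingMapHexConjectureFloorSharedEstimates.lean`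
(`--supports stmt-CriticalPhenomena-0808`; lead continuation prover-line-stmt-CriticalPhenomena-0808-c1-0).

`hexConjectureFloor_of_sharedEstimates`: **DCS Conjecture 2** (`SAWDevelopingMap.HexObservableLimit`, item
stmt-CriticalPhenomena-14003; = `SAWDefectDecoherence.HexObservableLimitR`) **+ half-plane arch tightness** (crux-10472's
registered open stub `stub_halfPlaneArchTightness`, verbatim) **+ the uniform injectivity modulus** (crux-10472's registered
open stub `stub_uniformModulus`, verbatim) **⟹ convergence in law of the critical hexagonal SAW to chordal SLE(8/3) on every
floor domain** (Jordan domain above the horizontal line through its marks, flat `ρ`-half-discs at both marks) with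
discrete-boundary lattice endpoints.  Composition of the landed `hexConjectureFloor_of_archTightness` (…FloorAssembly,
p116484: restriction cocycle ⟹ range identification ⟹ abstract curve upgrade) with `nonRetracingFloor_of_uniformModulus`
(…NonRetracingOfModulus, p116482: a modulus kills triple strands).

For the planners: crux stmt-CriticalPhenomena-10472's landed `FloorRatio.stub_floorObservableToSLE_of_estimates` reaches the
same conclusion (floor-vertex endpoints) from `HPAT → UIM → HexObservableLimit → HexTight`; the restriction closing of this
line removes the hypothesis `HexTight` (crux stmt-CriticalPhenomena-5423) on the floor class — tightness is an OUTPUT of range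
identification + non-retracing.  What remains of `HexConjecture` beyond these three estimates is the boundary-class /
endpoint extension `HexConjectureFloor → HexConjecture` (this line's `stub_marksAndEndpointsFloor`, 10472's W2).

Necessity (so that no stub of the skeleton is a strengthening of the crux): `hexConjectureFloor_of_hexConjecture` (7♭'s
hypothesis is a special case of the crux) and `nonRetracingFloor_of_hexConjecture` (the regularity stub 5♭ follows from the crux,
through 10472's `Negative.floorUniformModulus_of_hexConjecture` and `nonRetracingFloor_of_uniformModulus`).
-/

noncomputable section

open scoped Topology NNReal ENNReal
open Filter Set Metric MeasureTheory
open Literature.Probability.LatticeModels (HexVertex hexGraph hexCenter)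
open Literature.Probability.RandomPlanarGeometry
open Literature.Probability.RandomPlanarGeometry.SAW

namespace Summit.CriticalPhenomena.SAWScalingLimit.Theorems.HexConjecture.RootLocality

/-- **The floor class of DCS Conjecture 1 from the three shared estimates (no tightness input).**
`HexObservableLimit → HalfPlaneArchTightness → UniformModulus → HexConjectureFloor`: for every floor domain `(D; a, b)` at
scale `ρ` and every endpoint approximation by discrete-boundary vertices of `Ω_δ`, the critical hexagonal SAW law pushed to
`CurveClass ℂ` converges in law to chordal SLE(8/3).  The three hypotheses are, verbatim, item stmt-CriticalPhenomena-14003 and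
crux stmt-CriticalPhenomena-10472's registered stubs `stub_halfPlaneArchTightness`, `stub_uniformModulus`.
[cite: LawlerSchrammWerner2004SAW, §3.4 ("SAW satisfies restriction") and Prop. 2; DCS 2012 Conj. 2 as hypothesis] -/
theorem hexConjectureFloor_of_sharedEstimates
    (hO : Summit.CriticalPhenomena.SAWScalingLimit.Theses.SAWDevelopingMap.HexObservableLimit)
    (hT : ∀ ε : ℝ, 0 < ε → ∃ K : ℝ, 0 < K ∧ ∀ (n : ℕ), 1 ≤ n → ∀ (Λ B : Finset HexVertex)
      (s t : Sym2 HexVertex), s ∈ hexDomainBoundary Λ → t ∈ hexDomainBoundary Λ → s ≠ t →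
      dist (hexMidpoint s) (hexMidpoint t) ≤ n → (hexMidpoint t).im = (hexMidpoint s).im →
      (∀ v ∈ Λ, (hexMidpoint s).im < (hexCenter v).im) →
      (∀ v : HexVertex, v ∈ B ↔ ((hexMidpoint s).im < (hexCenter v).im ∧
        dist (hexCenter v) (hexMidpoint s) ≤ 2 * K * n)) →
      (∑ γ : HexMidEdgeSAW Λ s t, if ∃ v ∈ γ.verts, K * n ≤ dist (hexCenter v) (hexMidpoint s)
        then hexCriticalFugacity ^ γ.length else 0) ≤
      ε * ∑ γ : HexMidEdgeSAW B s t, hexCriticalFugacity ^ γ.length)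
    (hU : ∀ (D : DobrushinDomain) (ρ : ℝ) (a b : ℝ → HexVertex),
      (0 < ρ ∧ (D.pt 1).im = (D.pt 0).im ∧ D.carrier ⊆ {z : ℂ | (D.pt 0).im < z.im} ∧
      D.carrier ∩ ball (D.pt 0) ρ = {z : ℂ | (D.pt 0).im < z.im} ∩ ball (D.pt 0) ρ ∧
      D.carrier ∩ ball (D.pt 1) ρ = {z : ℂ | (D.pt 1).im < z.im} ∩ ball (D.pt 1) ρ) →
      (IsEmbEndpointApprox hexGraph hexCenter D a b ∧ ∀ᶠ δ : ℝ in 𝓝[>] 0,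
      (∃ u : HexVertex, hexGraph.Adj (a δ) u ∧ ((δ : ℂ) * hexCenter u).im ≤ (D.pt 0).im) ∧
      (∃ u : HexVertex, hexGraph.Adj (b δ) u ∧ ((δ : ℂ) * hexCenter u).im ≤ (D.pt 1).im)) →
      ∀ ε η : ℝ, 0 < ε → 0 < η → ∃ θ : ℝ, 0 < θ ∧ ∀ᶠ δ : ℝ in 𝓝[>] 0,
        hexSAWLaw D.carrier δ (a δ) (b δ) {γ | γ.curve ∉ CurveClass.modulusClass ε θ} ≤
          ENNReal.ofReal η) :
    ∀ (D : DobrushinDomain) (ρ : ℝ) (a b : ℝ → HexVertex),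
      (0 < ρ ∧ (D.pt 1).im = (D.pt 0).im ∧ D.carrier ⊆ {z : ℂ | (D.pt 0).im < z.im} ∧
        D.carrier ∩ ball (D.pt 0) ρ = {z : ℂ | (D.pt 0).im < z.im} ∩ ball (D.pt 0) ρ ∧
        D.carrier ∩ ball (D.pt 1) ρ = {z : ℂ | (D.pt 1).im < z.im} ∩ ball (D.pt 1) ρ) →
      IsEmbEndpointApprox hexGraph hexCenter D a b →
      (∀ᶠ δ : ℝ in 𝓝[>] 0,
        (a δ ∈ embMeshDomain hexGraph hexCenter D.carrier δ ∧
          ∃ w, hexGraph.Adj (a δ) w ∧ ¬ (hexDomainGraph D.carrier δ).Adj (a δ) w) ∧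
        (b δ ∈ embMeshDomain hexGraph hexCenter D.carrier δ ∧
          ∃ w, hexGraph.Adj (b δ) w ∧ ¬ (hexDomainGraph D.carrier δ).Adj (b δ) w)) →
      ConvergesInLawToSLE ((8 : ℝ≥0) / 3) D
        (fun δ (γ : HexDomainSAW D.carrier δ (a δ) (b δ)) => γ.curve)
        (fun δ => hexSAWLaw D.carrier δ (a δ) (b δ)) :=
  hexConjectureFloor_of_archTightness (hexObservableLimitR_iff_hexObservableLimit.2 hO) hT
    (nonRetracingFloor_of_uniformModulus hU)

/-- The floor-class statement is a special case of the crux: `HexConjecture → HexConjectureFloor` (so the foreign residual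
`stub_marksAndEndpointsFloor : HexConjectureFloor → HexConjecture` is an honest CONVERSE, not a strengthening). [folklore] -/
theorem hexConjectureFloor_of_hexConjecture
    (h : Summit.CriticalPhenomena.SAWScalingLimit.Theses.SAWDevelopingMap.HexConjecture) :
    ∀ (D : DobrushinDomain) (ρ : ℝ) (a b : ℝ → HexVertex),
      (0 < ρ ∧ (D.pt 1).im = (D.pt 0).im ∧ D.carrier ⊆ {z : ℂ | (D.pt 0).im < z.im} ∧
        D.carrier ∩ ball (D.pt 0) ρ = {z : ℂ | (D.pt 0).im < z.im} ∩ ball (D.pt 0) ρ ∧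
        D.carrier ∩ ball (D.pt 1) ρ = {z : ℂ | (D.pt 1).im < z.im} ∩ ball (D.pt 1) ρ) →
      IsEmbEndpointApprox hexGraph hexCenter D a b →
      (∀ᶠ δ : ℝ in 𝓝[>] 0,
        (a δ ∈ embMeshDomain hexGraph hexCenter D.carrier δ ∧
          ∃ w, hexGraph.Adj (a δ) w ∧ ¬ (hexDomainGraph D.carrier δ).Adj (a δ) w) ∧
        (b δ ∈ embMeshDomain hexGraph hexCenter D.carrier δ ∧
          ∃ w, hexGraph.Adj (b δ) w ∧ ¬ (hexDomainGraph D.carrier δ).Adj (b δ) w)) →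
      ConvergesInLawToSLE ((8 : ℝ≥0) / 3) D
        (fun δ (γ : HexDomainSAW D.carrier δ (a δ) (b δ)) => γ.curve)
        (fun δ => hexSAWLaw D.carrier δ (a δ) (b δ)) :=
  fun D _ a b _ hab _ => h D a b hab

/-- **Non-retracing is necessary.**  The crux implies the line's regularity stub 5♭ (`HexNonRetracingFloor`): DCS Conj. 1
⟹ uniform injectivity modulus on the floor class (crux-10472's `Negative.floorUniformModulus_of_hexConjecture`, p79732: SLE(8/3)
is a.s. simple and moduli are closed events) ⟹ no triple strands in law (`nonRetracingFloor_of_uniformModulus`, p116482).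
So `stub_nonRetracingFloor` is irrefutable short of refuting the crux. [folklore] -/
theorem nonRetracingFloor_of_hexConjecture
    (h : Summit.CriticalPhenomena.SAWScalingLimit.Theses.SAWDevelopingMap.HexConjecture) :
    ∀ (D : DobrushinDomain) (ρ : ℝ) (a b : ℝ → HexVertex),
      (0 < ρ ∧ (D.pt 1).im = (D.pt 0).im ∧ D.carrier ⊆ {z : ℂ | (D.pt 0).im < z.im} ∧
        D.carrier ∩ ball (D.pt 0) ρ = {z : ℂ | (D.pt 0).im < z.im} ∩ ball (D.pt 0) ρ ∧
        D.carrier ∩ ball (D.pt 1) ρ = {z : ℂ | (D.pt 1).im < z.im} ∩ ball (D.pt 1) ρ) →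
      IsEmbEndpointApprox hexGraph hexCenter D a b →
      (∀ᶠ δ : ℝ in 𝓝[>] 0,
        (a δ ∈ embMeshDomain hexGraph hexCenter D.carrier δ ∧
          ∃ w, hexGraph.Adj (a δ) w ∧ ¬ (hexDomainGraph D.carrier δ).Adj (a δ) w) ∧
        (b δ ∈ embMeshDomain hexGraph hexCenter D.carrier δ ∧
          ∃ w, hexGraph.Adj (b δ) w ∧ ¬ (hexDomainGraph D.carrier δ).Adj (b δ) w)) →
      ∀ ℓ : ℝ, 0 < ℓ → ∀ η : ℝ, 0 < η → ∃ ε : ℝ, 0 < ε ∧ ∀ᶠ δ : ℝ in 𝓝[>] 0,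
        hexSAWLaw D.carrier δ (a δ) (b δ)
            {γ | ∃ c : Curve ℂ, CurveClass.mk c = γ.curve ∧ ∃ s t : Fin 3 → unitInterval,
              (∀ i, s i ≤ t i) ∧ t 0 < s 1 ∧ t 1 < s 2 ∧
              (∀ i, ℓ ≤ Metric.diam ((⇑c) '' Set.Icc (s i) (t i))) ∧
              ∀ i j, Metric.hausdorffDist ((⇑c) '' Set.Icc (s i) (t i))
                ((⇑c) '' Set.Icc (s j) (t j)) ≤ ε} ≤ ENNReal.ofReal η :=
  nonRetracingFloor_of_uniformModulus
    (Summit.CriticalPhenomena.SAWScalingLimit.Theorems.ObservableToSLE.Negative.floorUniformModulus_of_hexConjecture h)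

end Summit.CriticalPhenomena.SAWScalingLimit.Theorems.HexConjecture.RootLocality

end
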